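import Summits.AtomisticToContinuum.Crystallization.Theorems.FreeSplittingCertificatesStrictSplittingRuleFarPencilIntegral

/-!
# `StrictSplittingRule` (stmt-AtomisticToContinuum-12560): the continuum far pencil with a FREE INTERFACE — cut-off version with explicit interface cost

Route `FreeSplittingCertificates`, crux r3 `StrictSplittingRule` (H12⋆ = `stub_coreJointCoercive`), unit b2b-freesplit-B gen 10.
VALUE = a tree THEOREM replacing the numerically sized interface penalty of HOME CERT.md §16 (6) by a formula — NOT a proof of H12⋆, NOT summit progress.

`…FarPencilIntegral` proves `∫ Num ≤ (17/200)∫ Den` for `C²` fields whose support misses the reference site.  The far region of the H12⋆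
architecture is an EXTERIOR domain `{|x| > R_*}` on which the (interpolated, co-rotated) displacement does NOT vanish at the inner boundary; CERT §16 (6)
handled this with a free-boundary flux sized numerically sector by sector (`κ_b`).  Here the interface is made rigorous WITHOUT surface integrals: multiply the
field by a `C²` cut-off `χ` vanishing near `0` (and `≡ 1` far out, though that is not needed for the statement) and apply the integrated pencil to `χ•v`.
Pointwise algebra (`fpDen_cut_le`, `fpNum_cut_ge`; Young's inequality on the PSD receipts form and on `|∇(χv)|²`, and `fpRec (c ⊗ v) ≤ 3|c|²|v|²` by
Lagrange's identity) turns the densities of `χ•v` into `χ²`-weighted densities of `v` plus an INTERFACE COST supported where `∇χ ≠ 0`: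

**`farPencil_cutoff_integral_le`**: for `v ∈ C²` with compact support (no condition at `0`), `χ ∈ C²` with `0 ∉ tsupport χ`, and any `η, η' > 0`,
`∫ χ²·[(1−η')·Read + Bare] ≤ (17/200)(1+η)·∫ χ²·Den + [(17/200)(1+η⁻¹)(12/5) + (η'⁻¹−1)/24]·∫ |x|⁻⁶|∇χ|²|v|²`
(`Read = (1/24)|x|⁻⁶|∇v|²`, `Bare = 2|x|⁻¹⁰⟪x,v⟫² − ¼|x|⁻⁸|v|²`, `Den = |x|⁻⁶(4/5)((div v)²+2|e(v)|²)`).  With `χ` rising from `0` to `1` across `R ≤ |x| ≤ 2R`,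
`|∇χ| ≲ 1/R` and the cost is `≲ ∫_{R<|x|<2R} |x|⁻⁸|v|²` — the `r⁻⁸`-mass part of the annulus form `B_A` of CERT §16 (6)/(7), now with an explicit constant
(`η = η' = 1`: receipts share `2×(17/200)`, cost coefficient `0.408·sup|x|²|∇χ|²`).  HONEST FRAMING: continuum statement about test fields and a cut-off;
the lattice→continuum transfer and the near certificate are untouched; NOT a proof of H12⋆, NOT summit progress.
-/

noncomputable section

open MeasureTheory Topology Filter

namespace Summit.AtomisticToContinuum.Crystallization.Theorems.StrictSplittingRuleBirth

variable {v : (Fin 3 → ℝ) → (Fin 3 → ℝ)} {χ : (Fin 3 → ℝ) → ℝ}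

/-! ## Objects -/

/-- Readout density `(1/24)|x|⁻⁶|G|²`. -/
def fpRead (x : Fin 3 → ℝ) (G : Fin 3 → Fin 3 → ℝ) : ℝ := 1 / 24 * (fpSq x)⁻¹ ^ 3 * fpFrob G

/-- Bare density `2|x|⁻¹⁰⟪x,v⟫² − ¼|x|⁻⁸|v|²` (radial deficit minus tangential credit). -/
def fpBare (x v : Fin 3 → ℝ) : ℝ := 2 * (fpSq x)⁻¹ ^ 5 * fpDot x v ^ 2 - 1 / 4 * (fpSq x)⁻¹ ^ 4 * fpSq v

/-- `Num = Read + Bare`. -/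
theorem fpNum_eq_read_add_bare (x v : Fin 3 → ℝ) (G : Fin 3 → Fin 3 → ℝ) : fpNum x v G = fpRead x G + fpBare x v := by
  unfold fpNum fpRead fpBare fpSq
  ring

/-- The gradient of a scalar function: `fpGradS χ x i = ∂ᵢχ(x) = fderiv ℝ χ x eᵢ`. -/
def fpGradS (χ : (Fin 3 → ℝ) → ℝ) (x : Fin 3 → ℝ) : Fin 3 → ℝ := fun i => fderiv ℝ χ x (fpE i)

/-- The gradient of a cut-off field: `∇(χv) = χ∇v + ∇χ ⊗ v`, as a matrix built from `t = χ(x)`, `c = ∇χ(x)`, `v = v(x)`, `G = ∇v(x)`. -/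
def fpCutGrad (t : ℝ) (c v : Fin 3 → ℝ) (G : Fin 3 → Fin 3 → ℝ) : Fin 3 → Fin 3 → ℝ := fun i j => t * G i j + c i * v j

/-! ## Pointwise algebra -/

/-- The receipts form is nonnegative. -/
theorem fpRec_nonneg (G : Fin 3 → Fin 3 → ℝ) : 0 ≤ fpRec G := by
  unfold fpRec fpTr fpSymSq; positivity

/-- Young's inequality for the PSD receipts form: `q(A+B) ≤ (1+η)q(A) + (1+η⁻¹)q(B)`. -/
theorem fpRec_add_le (A B : Fin 3 → Fin 3 → ℝ) {η : ℝ} (hη : 0 < η) :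
    fpRec (fun i j => A i j + B i j) ≤ (1 + η) * fpRec A + (1 + η⁻¹) * fpRec B := by
  have hid : fpRec (fun i j => A i j + B i j) + η⁻¹ * fpRec (fun i j => η * A i j - B i j) =
      (1 + η) * fpRec A + (1 + η⁻¹) * fpRec B := by
    unfold fpRec fpTr fpSymSq
    field_simp
    ring
  have hnn : 0 ≤ η⁻¹ * fpRec (fun i j => η * A i j - B i j) := mul_nonneg (inv_nonneg.2 hη.le) (fpRec_nonneg _)
  linarith

/-- Receipts of a rank-one matrix: `q(c ⊗ v) = (4/5)(|c|²|v|² + 2⟪c,v⟫²) ≤ (12/5)|c|²|v|²` (Lagrange's identity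
`|c|²|v|² − ⟪c,v⟫² = |c × v|²`). -/
theorem fpRec_outer_le (c v : Fin 3 → ℝ) : fpRec (fun i j => c i * v j) ≤ 12 / 5 * (fpSq c * fpSq v) := by
  have hid : 12 / 5 * (fpSq c * fpSq v) - fpRec (fun i j => c i * v j) =
      8 / 5 * ((c 1 * v 2 - c 2 * v 1) ^ 2 + (c 2 * v 0 - c 0 * v 2) ^ 2 + (c 0 * v 1 - c 1 * v 0) ^ 2) := by
    unfold fpRec fpTr fpSymSq fpSq
    ring
  have hnn : 0 ≤ 8 / 5 * ((c 1 * v 2 - c 2 * v 1) ^ 2 + (c 2 * v 0 - c 0 * v 2) ^ 2 + (c 0 * v 1 - c 1 * v 0) ^ 2) := by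
    positivity
  linarith

/-- Receipts of a scaled matrix. -/
theorem fpRec_smul (t : ℝ) (G : Fin 3 → Fin 3 → ℝ) : fpRec (fun i j => t * G i j) = t ^ 2 * fpRec G := by
  unfold fpRec fpTr fpSymSq; ring

/-- **Receipts of the cut-off field**: `Den(x, χG + c⊗v) ≤ (1+η)χ²·Den(x,G) + (1+η⁻¹)(12/5)·|x|⁻⁶|c|²|v|²`. -/
theorem fpDen_cut_le (x : Fin 3 → ℝ) (t : ℝ) (c v : Fin 3 → ℝ) (G : Fin 3 → Fin 3 → ℝ) {η : ℝ} (hη : 0 < η) :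
    fpDen x (fpCutGrad t c v G) ≤
      (1 + η) * (t ^ 2 * fpDen x G) + (1 + η⁻¹) * (12 / 5) * ((fpSq x)⁻¹ ^ 3 * (fpSq c * fpSq v)) := by
  have hu : 0 ≤ (fpSq x)⁻¹ ^ 3 := pow_nonneg (inv_nonneg.2 (fpSq_nonneg x)) 3
  have h1 := fpRec_add_le (fun i j => t * G i j) (fun i j => c i * v j) hη
  have h2 := fpRec_outer_le c v
  have h3 := fpRec_smul t G
  have hη' : 0 ≤ 1 + η⁻¹ := by positivity
  have h4 : fpRec (fpCutGrad t c v G) ≤ (1 + η) * (t ^ 2 * fpRec G) + (1 + η⁻¹) * (12 / 5 * (fpSq c * fpSq v)) := by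
    have : fpRec (fpCutGrad t c v G) = fpRec (fun i j => t * G i j + c i * v j) := rfl
    rw [this]
    calc fpRec (fun i j => t * G i j + c i * v j)
        ≤ (1 + η) * fpRec (fun i j => t * G i j) + (1 + η⁻¹) * fpRec (fun i j => c i * v j) := h1
      _ ≤ (1 + η) * (t ^ 2 * fpRec G) + (1 + η⁻¹) * (12 / 5 * (fpSq c * fpSq v)) := by
          rw [h3]; exact add_le_add le_rfl (mul_le_mul_of_nonneg_left h2 hη')
  unfold fpDen
  calc (fpSq x)⁻¹ ^ 3 * fpRec (fpCutGrad t c v G)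
      ≤ (fpSq x)⁻¹ ^ 3 * ((1 + η) * (t ^ 2 * fpRec G) + (1 + η⁻¹) * (12 / 5 * (fpSq c * fpSq v))) :=
        mul_le_mul_of_nonneg_left h4 hu
    _ = (1 + η) * (t ^ 2 * ((fpSq x)⁻¹ ^ 3 * fpRec G)) +
          (1 + η⁻¹) * (12 / 5) * ((fpSq x)⁻¹ ^ 3 * (fpSq c * fpSq v)) := by ring

/-- **Frobenius norm of the cut-off gradient from below** (Young): `|χG + c⊗v|² ≥ (1−η')χ²|G|² − (η'⁻¹−1)|c|²|v|²`. -/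
theorem fpFrob_cut_ge (t : ℝ) (c v : Fin 3 → ℝ) (G : Fin 3 → Fin 3 → ℝ) {η' : ℝ} (hη : 0 < η') :
    (1 - η') * (t ^ 2 * fpFrob G) - (η'⁻¹ - 1) * (fpSq c * fpSq v) ≤ fpFrob (fpCutGrad t c v G) := by
  have hid : fpFrob (fpCutGrad t c v G) - ((1 - η') * (t ^ 2 * fpFrob G) - (η'⁻¹ - 1) * (fpSq c * fpSq v)) =
      η'⁻¹ * fpFrob (fun i j => η' * (t * G i j) + c i * v j) := by
    unfold fpFrob fpCutGrad fpSq
    field_simp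
    ring
  have hnn : 0 ≤ η'⁻¹ * fpFrob (fun i j => η' * (t * G i j) + c i * v j) := by
    refine mul_nonneg (inv_nonneg.2 hη.le) ?_
    unfold fpFrob; positivity
  linarith

/-- Bare density of the cut-off field: `Bare(x, χv) = χ²·Bare(x, v)`. -/
theorem fpBare_smul (x : Fin 3 → ℝ) (t : ℝ) (v : Fin 3 → ℝ) : fpBare x (t • v) = t ^ 2 * fpBare x v := by
  simp only [fpBare, fpDot, fpSq, Pi.smul_apply, smul_eq_mul]
  ring

/-- **Demand of the cut-off field from below**:
`Num(x, χv, χG + c⊗v) ≥ χ²·[(1−η')Read(x,G) + Bare(x,v)] − ((η'⁻¹−1)/24)·|x|⁻⁶|c|²|v|²`. -/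
theorem fpNum_cut_ge (x : Fin 3 → ℝ) (t : ℝ) (c v : Fin 3 → ℝ) (G : Fin 3 → Fin 3 → ℝ) {η' : ℝ} (hη : 0 < η') :
    t ^ 2 * ((1 - η') * fpRead x G + fpBare x v) - (η'⁻¹ - 1) / 24 * ((fpSq x)⁻¹ ^ 3 * (fpSq c * fpSq v)) ≤
      fpNum x (t • v) (fpCutGrad t c v G) := by
  rw [fpNum_eq_read_add_bare, fpBare_smul]
  have hu : 0 ≤ (fpSq x)⁻¹ ^ 3 := pow_nonneg (inv_nonneg.2 (fpSq_nonneg x)) 3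
  have h := mul_le_mul_of_nonneg_left (fpFrob_cut_ge t c v G hη) hu
  unfold fpRead
  nlinarith [h]

/-! ## Calculus: `∇(χ•v) = χ∇v + ∇χ ⊗ v` -/

/-- The gradient matrix of a cut-off field. -/
theorem fpGrad_smul {x : Fin 3 → ℝ} (hχ : DifferentiableAt ℝ χ x) (hv : DifferentiableAt ℝ v x) :
    fpGrad (fun y => χ y • v y) x = fpCutGrad (χ x) (fpGradS χ x) (v x) (fpGrad v x) := by
  funext i j
  simp only [fpGrad, fpCutGrad, fpGradS, fderiv_fun_smul hχ hv, _root_.add_apply, _root_.smul_apply,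
    ContinuousLinearMap.smulRight_apply, Pi.add_apply, Pi.smul_apply, smul_eq_mul]

/-! ## Integrability of the weighted densities -/

/-- A real function continuous at every `x ≠ 0`, vanishing near `0`, and supported in a compact set is integrable. -/
theorem fp_integrable₀ {g : (Fin 3 → ℝ) → ℝ} {K : Set (Fin 3 → ℝ)} (hK : IsCompact K)
    (hg : ∀ y, y ≠ 0 → ContinuousAt g y) (h0 : g =ᶠ[𝓝 0] fun _ => (0 : ℝ)) (hs : ∀ y ∉ K, g y = 0) :
    Integrable g := by
  have hcont : Continuous g := by
    refine continuous_iff_continuousAt.2 fun y => ?_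
    by_cases hy : y = 0
    · subst hy; exact h0.continuousAt
    · exact hg y hy
  exact hcont.integrable_of_hasCompactSupport (HasCompactSupport.intro hK hs)

/-- A scalar `C²` cut-off and its gradient vanish near `0` when `0 ∉ tsupport χ`. -/
theorem fpGradS_eventually_zero (hχ0 : (0 : Fin 3 → ℝ) ∉ tsupport χ) :
    ∀ᶠ y in 𝓝 (0 : Fin 3 → ℝ), χ y = 0 ∧ fpGradS χ y = 0 := by
  refine Filter.eventually_of_mem ((isClosed_tsupport χ).isOpen_compl.mem_nhds hχ0) fun y hy => ?_
  refine ⟨image_eq_zero_of_notMem_tsupport hy, ?_⟩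
  funext i
  have : fderiv ℝ χ y = 0 := image_eq_zero_of_notMem_tsupport fun h => hy (tsupport_fderiv_subset ℝ h)
  simp [fpGradS, this]

section integrability
variable (hv : ContDiff ℝ 2 v) (hc : HasCompactSupport v) (hχ : ContDiff ℝ 2 χ) (hχ0 : (0 : Fin 3 → ℝ) ∉ tsupport χ)
include hv hc hχ hχ0

/-- `χ²·[(1−η')Read + Bare]` along the field is integrable. -/
theorem integrable_cut_demand (η' : ℝ) :
    Integrable fun y => χ y ^ 2 * ((1 - η') * fpRead y (fpGrad v y) + fpBare y (v y)) := by
  have hvc : Continuous v := hv.continuous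
  have hGc : Continuous (fpGrad v) := continuous_fpGrad hv
  have hχc : Continuous χ := hχ.continuous
  refine fp_integrable₀ hc (fun y hy => ?_) ?_ (fun y hy => ?_)
  · have hu := continuousAt_fpSq_inv hy
    have hF : Continuous fun z : Fin 3 → ℝ => fpFrob (fpGrad v z) := by unfold fpFrob; fun_prop
    have hD : Continuous fun z : Fin 3 → ℝ => fpDot z (v z) ^ 2 := by unfold fpDot; fun_prop
    have hV : Continuous fun z : Fin 3 → ℝ => fpSq (v z) := by unfold fpSq; fun_prop
    unfold fpRead fpBare
    exact ((hχc.pow 2).continuousAt).mul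
      (((((hu.pow 3).const_mul (1 / 24)).mul hF.continuousAt).const_mul (1 - η')).add
        ((((hu.pow 5).const_mul 2).mul hD.continuousAt).sub (((hu.pow 4).const_mul (1 / 4)).mul hV.continuousAt)))
  · filter_upwards [fpGradS_eventually_zero hχ0] with y hy
    simp [hy.1]
  · have h1 : v y = 0 := image_eq_zero_of_notMem_tsupport hy
    have h2 : fderiv ℝ v y = 0 := image_eq_zero_of_notMem_tsupport fun h => hy (tsupport_fderiv_subset ℝ h)
    simp [fpRead, fpBare, fpFrob, fpGrad, fpDot, fpSq, h1, h2]

/-- `χ²·Den` along the field is integrable. -/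
theorem integrable_cut_receipts : Integrable fun y => χ y ^ 2 * fpDen y (fpGrad v y) := by
  have hGc : Continuous (fpGrad v) := continuous_fpGrad hv
  have hχc : Continuous χ := hχ.continuous
  refine fp_integrable₀ hc (fun y hy => ?_) ?_ (fun y hy => ?_)
  · exact ((hχc.pow 2).continuousAt).mul (continuousAt_fpDen hv hy)
  · filter_upwards [fpGradS_eventually_zero hχ0] with y hy
    simp [hy.1]
  · have h2 : fderiv ℝ v y = 0 := image_eq_zero_of_notMem_tsupport fun h => hy (tsupport_fderiv_subset ℝ h)
    simp [fpDen, fpRec, fpGrad, fpTr, fpSymSq, h2]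

/-- The interface cost density `|x|⁻⁶|∇χ|²|v|²` is integrable. -/
theorem integrable_cut_cost : Integrable fun y => (fpSq y)⁻¹ ^ 3 * (fpSq (fpGradS χ y) * fpSq (v y)) := by
  have hvc : Continuous v := hv.continuous
  have hχ' : Continuous (fpGradS χ) := by
    have h := hχ.continuous_fderiv (by simp)
    exact continuous_pi fun i => h.clm_apply continuous_const
  refine fp_integrable₀ hc (fun y hy => ?_) ?_ (fun y hy => ?_)
  · have hu := continuousAt_fpSq_inv hy
    have hA : Continuous fun z : Fin 3 → ℝ => fpSq (fpGradS χ z) * fpSq (v z) := by unfold fpSq; fun_prop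
    exact (hu.pow 3).mul hA.continuousAt
  · filter_upwards [fpGradS_eventually_zero hχ0] with y hy
    simp [hy.2, fpSq]
  · have h1 : v y = 0 := image_eq_zero_of_notMem_tsupport hy
    simp [fpSq, h1]

end integrability

/-! ## The cut-off far pencil -/

/-- **THE CONTINUUM FAR PENCIL WITH A FREE INTERFACE.**  For every `C²` vector field `v` with compact support (no condition at the reference site),
every `C²` scalar cut-off `χ` with `0 ∉ tsupport χ`, and all `η, η' > 0`:
`∫ χ²[(1−η')·Read + Bare] ≤ (17/200)(1+η)·∫ χ²·Den + [(17/200)(1+η⁻¹)(12/5) + (η'⁻¹−1)/24]·∫ |x|⁻⁶|∇χ|²|v|²`.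
The last integral lives where `∇χ ≠ 0` (the interface annulus): the explicit price of cutting the far region free.  NOT a proof of H12⋆, NOT summit progress. -/
theorem farPencil_cutoff_integral_le (hv : ContDiff ℝ 2 v) (hc : HasCompactSupport v) (hχ : ContDiff ℝ 2 χ)
    (hχ0 : (0 : Fin 3 → ℝ) ∉ tsupport χ) {η η' : ℝ} (hη : 0 < η) (hη' : 0 < η') :
    ∫ x, χ x ^ 2 * ((1 - η') * fpRead x (fpGrad v x) + fpBare x (v x)) ≤
      17 / 200 * (1 + η) * (∫ x, χ x ^ 2 * fpDen x (fpGrad v x)) +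
        (17 / 200 * ((1 + η⁻¹) * (12 / 5)) + (η'⁻¹ - 1) / 24) *
          ∫ x, (fpSq x)⁻¹ ^ 3 * (fpSq (fpGradS χ x) * fpSq (v x)) := by
  -- the cut-off field
  set w : (Fin 3 → ℝ) → (Fin 3 → ℝ) := fun y => χ y • v y with hw
  have hw2 : ContDiff ℝ 2 w := hχ.smul hv
  have hwc : HasCompactSupport w := hc.smul_left (f := χ)
  have hw0 : (0 : Fin 3 → ℝ) ∉ tsupport w := fun h => hχ0 (tsupport_smul_subset_left χ v h)
  have hG : ∀ x, fpGrad w x = fpCutGrad (χ x) (fpGradS χ x) (v x) (fpGrad v x) := fun x =>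
    fpGrad_smul (hχ.differentiable (by simp) x) (hv.differentiable (by simp) x)
  have hmain := farPencil_integral_le hw2 hwc hw0
  -- integrability
  have iN := integrable_fpNum hw2 hwc hw0
  have iD := integrable_fpDen hw2 hwc hw0
  have i1 := integrable_cut_demand hv hc hχ hχ0 η'
  have i2 := integrable_cut_receipts hv hc hχ hχ0
  have i3 := integrable_cut_cost hv hc hχ hχ0
  -- pointwise bounds along the field
  have hlow : ∀ x, χ x ^ 2 * ((1 - η') * fpRead x (fpGrad v x) + fpBare x (v x)) -
      (η'⁻¹ - 1) / 24 * ((fpSq x)⁻¹ ^ 3 * (fpSq (fpGradS χ x) * fpSq (v x))) ≤ fpNum x (w x) (fpGrad w x) := by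
    intro x; rw [hG x]; exact fpNum_cut_ge x (χ x) (fpGradS χ x) (v x) (fpGrad v x) hη'
  have hup : ∀ x, fpDen x (fpGrad w x) ≤ (1 + η) * (χ x ^ 2 * fpDen x (fpGrad v x)) +
      (1 + η⁻¹) * (12 / 5) * ((fpSq x)⁻¹ ^ 3 * (fpSq (fpGradS χ x) * fpSq (v x))) := by
    intro x; rw [hG x]; exact fpDen_cut_le x (χ x) (fpGradS χ x) (v x) (fpGrad v x) hη
  -- integrate
  have I1 : (∫ x, χ x ^ 2 * ((1 - η') * fpRead x (fpGrad v x) + fpBare x (v x))) -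
      (η'⁻¹ - 1) / 24 * ∫ x, (fpSq x)⁻¹ ^ 3 * (fpSq (fpGradS χ x) * fpSq (v x)) ≤
      ∫ x, fpNum x (w x) (fpGrad w x) := by
    rw [← integral_const_mul, ← integral_sub i1 (i3.const_mul _)]
    exact integral_mono (i1.sub (i3.const_mul _)) iN hlow
  have I2 : ∫ x, fpDen x (fpGrad w x) ≤ (1 + η) * (∫ x, χ x ^ 2 * fpDen x (fpGrad v x)) +
      (1 + η⁻¹) * (12 / 5) * ∫ x, (fpSq x)⁻¹ ^ 3 * (fpSq (fpGradS χ x) * fpSq (v x)) := by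
    rw [← integral_const_mul, ← integral_const_mul, ← integral_add (i2.const_mul _) (i3.const_mul _)]
    exact integral_mono iD ((i2.const_mul _).add (i3.const_mul _)) hup
  have I3 : 17 / 200 * ∫ x, fpDen x (fpGrad w x) ≤ 17 / 200 * ((1 + η) * (∫ x, χ x ^ 2 * fpDen x (fpGrad v x)) +
      (1 + η⁻¹) * (12 / 5) * ∫ x, (fpSq x)⁻¹ ^ 3 * (fpSq (fpGradS χ x) * fpSq (v x))) :=
    mul_le_mul_of_nonneg_left I2 (by norm_num)
  linarith [I1, I3, hmain]

end Summit.AtomisticToContinuum.Crystallization.Theorems.StrictSplittingRuleBirth
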